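import Literature.Geometry.Lorentzian.InitialDataDilation
import Mathlib.Analysis.Calculus.ContDiff.Bounds
import Mathlib.Analysis.SpecialFunctions.SmoothTransition
import Mathlib.Data.Nat.Choose.Sum
import HarnessLib

/-!
# Cut-off interpolation of initial data sets on `E3` (the first step of gluing constructions)

Topic `Literature/Geometry/Lorentzian`. Everything in this file is PROVED (definitions with bodies,
theorems); there are no named facts.

Gluing constructions for the Einstein constraint equations (Corvino 2000; Corvino–Schoen 2006;
Chruściel–Delay 2003; Li–Yu 2015; Li–Mei 2020) all start in the same way: two initial data sets
`(h₁, k₁)`, `(h₂, k₂)` on (a region of) `ℝ³` are patched by a smooth cut-off `φ` with values in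
`[0, 1]`,
`(h̃, k̃) = (φ h₁ + (1 − φ) h₂, φ k₁ + (1 − φ) k₂)`
— Li–Mei, *A construction of collapsing spacetimes in vacuum*, arXiv:2005.01249, proof of Prop. 4.1,
p. 22: "`(g̃, π̃) = (φ ḡ + (1 − φ) ḡ_{m,a⃗}, φ π̄ + (1 − φ) π̄_{m,a⃗})`" — which is again an initial
data set (a convex combination of Riemannian metrics is Riemannian), equal to `(h₁, k₁)` where
`φ = 1` and to `(h₂, k₂)` where `φ = 0` (so it keeps the constraint equations there, by locality of
the constraint map, Bartnik–Isenberg 2004, §2), and whose `C^k`-distance to any model is controlled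
by those of the two pieces and the `C^k` norms of `φ` (Leibniz rule). This file provides exactly this:

* `norm_iteratedFDeriv_mul_le_of_le`, `norm_iteratedFDeriv_cutoff_interpolate_sub_le` — the
  Leibniz `C^k` bounds on an open set: `‖∂ⁱ(φ u)‖ ≤ 2ⁱ C ε` and
  `‖∂ⁱ(φ f₁ + (1 − φ) f₂ − g)‖ ≤ 2ⁱ (2C + 1) ε` from `‖∂ʲ φ‖ ≤ C`, `‖∂ʲ(f_* − g)‖ ≤ ε` (`j ≤ n`);
  `exists_bound_iteratedFDeriv` — a smooth function has bounded derivatives of order `≤ n` on a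
  bounded set;
* `radialCutoff σ₁ σ₂` — a smooth radial cut-off on an inner product space, `= 1` on `{‖y‖ ≤ σ₁}`,
  `= 0` on `{σ₂ ≤ ‖y‖}`, values in `[0, 1]` (`0 ≤ σ₁ < σ₂`);
* `InitialDataSet.interpolate D₁ D₂ hφ h01` — **the interpolated initial data set**
  `(φ h₁ + (1 − φ) h₂, φ k₁ + (1 − φ) k₂)` on `E3` for a smooth `φ : E3 → [0, 1]`, with its field
  lemmas, `= D₁` where `φ = 1`, `= D₂` where `φ = 0`, and the constraint functions of the
  interpolated data agree with those of `D₁` (`D₂`) wherever `φ` is locally `1` (`0`)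
  (`hamiltonianConstraintFn_interpolate_of_eventually_eq_one`, …).

## References

* J. Li, H. Mei, *A construction of collapsing spacetimes in vacuum*, Comm. Math. Phys. 378
  (2020), arXiv:2005.01249, proof of Prop. 4.1, p. 22 (key `LiMei2020`).
* J. Corvino, *Scalar curvature deformation and a gluing construction for the Einstein constraint
  equations*, Comm. Math. Phys. 214 (2000), §4 (key `Corvino2000`).
* R. Bartnik, J. Isenberg, *The constraint equations* (2004), §2 (key `BartnikIsenberg2004`).
-/

noncomputable section

open Bundle Set Function Filter Manifold TopologicalSpace
open scoped Manifold ContDiff Topology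

namespace Literature.Geometry.Lorentzian

/-! ### Leibniz `C^k` bounds for cut-off products and interpolations -/

section Bounds

variable {E : Type*} [NormedAddCommGroup E] [NormedSpace ℝ E]

/-- **Leibniz bound.** On an open set `s`, if `‖∂ʲφ‖ ≤ C` and `‖∂ʲu‖ ≤ ε` on `s` for all `j ≤ n`
(`φ`, `u` of class `C^n` on `s`), then `‖∂ⁱ(φ u)(y)‖ ≤ 2ⁱ C ε` for `i ≤ n`, `y ∈ s`
(`norm_iteratedFDerivWithin_mul_le` and `∑ⱼ (i choose j) = 2ⁱ`). [folklore] -/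
theorem norm_iteratedFDeriv_mul_le_of_le {s : Set E} (hs : IsOpen s) {n : ℕ} {φ u : E → ℝ}
    (hφ : ContDiffOn ℝ n φ s) (hu : ContDiffOn ℝ n u s) {C ε : ℝ}
    (hC : ∀ j ≤ n, ∀ y ∈ s, ‖iteratedFDeriv ℝ j φ y‖ ≤ C)
    (hε : ∀ j ≤ n, ∀ y ∈ s, ‖iteratedFDeriv ℝ j u y‖ ≤ ε) {i : ℕ} (hi : i ≤ n) {y : E}
    (hy : y ∈ s) : ‖iteratedFDeriv ℝ i (fun z ↦ φ z * u z) y‖ ≤ 2 ^ i * C * ε := by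
  have hsu : UniqueDiffOn ℝ s := hs.uniqueDiffOn
  have hC0 : 0 ≤ C := (norm_nonneg _).trans (hC 0 (Nat.zero_le _) y hy)
  rw [← iteratedFDerivWithin_of_isOpen i hs hy]
  have hin : (i : ℕ∞ω) ≤ (n : ℕ∞ω) := by exact_mod_cast hi
  refine (norm_iteratedFDerivWithin_mul_le hφ hu hsu hy hin).trans ?_
  have hterm : ∀ j ∈ Finset.range (i + 1),
      (i.choose j : ℝ) * ‖iteratedFDerivWithin ℝ j φ s y‖ *
          ‖iteratedFDerivWithin ℝ (i - j) u s y‖ ≤ (i.choose j : ℝ) * C * ε := fun j hj ↦ by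
    have hj : j ≤ i := Nat.lt_succ_iff.mp (Finset.mem_range.mp hj)
    rw [iteratedFDerivWithin_of_isOpen j hs hy, iteratedFDerivWithin_of_isOpen (i - j) hs hy]
    have h1 := hC j (hj.trans hi) y hy
    have h2 := hε (i - j) ((Nat.sub_le i j).trans hi) y hy
    have hc : (0 : ℝ) ≤ i.choose j := Nat.cast_nonneg _
    exact mul_le_mul (mul_le_mul_of_nonneg_left h1 hc) h2 (norm_nonneg _) (mul_nonneg hc hC0)
  refine (Finset.sum_le_sum hterm).trans_eq ?_
  rw [← Finset.sum_mul, ← Finset.sum_mul]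
  congr 2
  have h := Nat.sum_range_choose i
  exact_mod_cast h

/-- `‖∂ʲ(1 − φ)‖ ≤ C + 1` from `‖∂ʲ φ‖ ≤ C` (`j ≤ n`, on an open set). [folklore] -/
theorem norm_iteratedFDeriv_one_sub_le {s : Set E} (hs : IsOpen s) {n : ℕ} {φ : E → ℝ}
    (hφ : ContDiffOn ℝ n φ s) {C : ℝ} (hC : ∀ j ≤ n, ∀ y ∈ s, ‖iteratedFDeriv ℝ j φ y‖ ≤ C)
    {j : ℕ} (hj : j ≤ n) {y : E} (hy : y ∈ s) :
    ‖iteratedFDeriv ℝ j (fun z ↦ 1 - φ z) y‖ ≤ C + 1 := by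
  have hφy : ContDiffAt ℝ j φ y := (hφ.of_le (by exact_mod_cast hj)).contDiffAt (hs.mem_nhds hy)
  have e : (fun z ↦ 1 - φ z) = (fun _ ↦ (1 : ℝ)) - φ := rfl
  rw [e, iteratedFDeriv_sub_apply contDiffAt_const hφy]
  refine (norm_sub_le _ _).trans ?_
  rw [add_comm C 1]
  refine add_le_add ?_ (hC j hj y hy)
  rcases Nat.eq_zero_or_pos j with rfl | hj0
  · rw [norm_iteratedFDeriv_zero, norm_one]
  · rw [iteratedFDeriv_const_of_ne hj0.ne', Pi.zero_apply, norm_zero]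
    exact zero_le_one

/-- **`C^k` bound for cut-off interpolations** (the estimate behind "`(g̃ − ḡ, π̃ − π̄)` is `O(ε)` in
`C^k`" in gluing constructions, Li–Mei arXiv:2005.01249, p. 22): on an open set `s`, if
`‖∂ʲ φ‖ ≤ C`, `‖∂ʲ(f₁ − g)‖ ≤ ε`, `‖∂ʲ(f₂ − g)‖ ≤ ε` on `s` for `j ≤ n`, then
`‖∂ⁱ(φ f₁ + (1 − φ) f₂ − g)(y)‖ ≤ 2ⁱ (2C + 1) ε` for `i ≤ n`, `y ∈ s`
(`φ f₁ + (1 − φ) f₂ − g = φ (f₁ − g) + (1 − φ)(f₂ − g)` and the Leibniz bound).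
[cite: LiMei2020, proof of Prop. 4.1, p. 22] -/
theorem norm_iteratedFDeriv_cutoff_interpolate_sub_le {s : Set E} (hs : IsOpen s) {n : ℕ}
    {φ f₁ f₂ g : E → ℝ} (hφ : ContDiffOn ℝ n φ s) (hf₁ : ContDiffOn ℝ n f₁ s)
    (hf₂ : ContDiffOn ℝ n f₂ s) (hg : ContDiffOn ℝ n g s) {C ε : ℝ}
    (hC : ∀ j ≤ n, ∀ y ∈ s, ‖iteratedFDeriv ℝ j φ y‖ ≤ C)
    (h₁ : ∀ j ≤ n, ∀ y ∈ s, ‖iteratedFDeriv ℝ j (fun z ↦ f₁ z - g z) y‖ ≤ ε)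
    (h₂ : ∀ j ≤ n, ∀ y ∈ s, ‖iteratedFDeriv ℝ j (fun z ↦ f₂ z - g z) y‖ ≤ ε) {i : ℕ} (hi : i ≤ n)
    {y : E} (hy : y ∈ s) :
    ‖iteratedFDeriv ℝ i (fun z ↦ φ z * f₁ z + (1 - φ z) * f₂ z - g z) y‖ ≤
      2 ^ i * (2 * C + 1) * ε := by
  have hfun : (fun z ↦ φ z * f₁ z + (1 - φ z) * f₂ z - g z) =
      (fun z ↦ φ z * (f₁ z - g z)) + fun z ↦ (1 - φ z) * (f₂ z - g z) := by
    funext z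
    simp only [Pi.add_apply]
    ring
  have hφ' : ContDiffOn ℝ n (fun z ↦ 1 - φ z) s := contDiffOn_const.sub hφ
  have hu₁ : ContDiffOn ℝ n (fun z ↦ f₁ z - g z) s := hf₁.sub hg
  have hu₂ : ContDiffOn ℝ n (fun z ↦ f₂ z - g z) s := hf₂.sub hg
  have hC' : ∀ j ≤ n, ∀ y ∈ s, ‖iteratedFDeriv ℝ j (fun z ↦ 1 - φ z) y‖ ≤ C + 1 :=
    fun j hj z hz ↦ norm_iteratedFDeriv_one_sub_le hs hφ hC hj hz
  have hA := norm_iteratedFDeriv_mul_le_of_le hs hφ hu₁ hC h₁ hi hy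
  have hB := norm_iteratedFDeriv_mul_le_of_le hs hφ' hu₂ hC' h₂ hi hy
  have hsy : s ∈ 𝓝 y := hs.mem_nhds hy
  have hi' : ((i : ℕ) : ℕ∞ω) ≤ (n : ℕ∞ω) := by exact_mod_cast hi
  have hAd : ContDiffAt ℝ i (fun z ↦ φ z * (f₁ z - g z)) y :=
    ((hφ.mul hu₁).of_le hi').contDiffAt hsy
  have hBd : ContDiffAt ℝ i (fun z ↦ (1 - φ z) * (f₂ z - g z)) y :=
    ((hφ'.mul hu₂).of_le hi').contDiffAt hsy
  rw [hfun, iteratedFDeriv_add_apply hAd hBd]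
  calc ‖iteratedFDeriv ℝ i (fun z ↦ φ z * (f₁ z - g z)) y +
          iteratedFDeriv ℝ i (fun z ↦ (1 - φ z) * (f₂ z - g z)) y‖
        ≤ 2 ^ i * C * ε + 2 ^ i * (C + 1) * ε := (norm_add_le _ _).trans (add_le_add hA hB)
    _ = 2 ^ i * (2 * C + 1) * ε := by ring

/-- **A smooth function has bounded derivatives of order `≤ n` on a bounded set** of a
finite-dimensional space (each `∂ʲ φ` is continuous, hence bounded on the compact closure).
[folklore] -/
theorem exists_bound_iteratedFDeriv [FiniteDimensional ℝ E] {φ : E → ℝ} (hφ : ContDiff ℝ ∞ φ)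
    {s : Set E} (hs : Bornology.IsBounded s) (n : ℕ) :
    ∃ C, ∀ j ≤ n, ∀ y ∈ s, ‖iteratedFDeriv ℝ j φ y‖ ≤ C := by
  haveI : ProperSpace E := FiniteDimensional.proper ℝ E
  have hK : IsCompact (closure s) := hs.isCompact_closure
  have hj : ∀ j : ℕ, ∃ C, ∀ y ∈ s, ‖iteratedFDeriv ℝ j φ y‖ ≤ C := fun j ↦ by
    obtain ⟨C, hC⟩ := hK.exists_bound_of_continuousOn
      ((hφ.continuous_iteratedFDeriv (m := j) (by exact_mod_cast le_top)).continuousOn)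
    exact ⟨C, fun y hy ↦ hC y (subset_closure hy)⟩
  induction n with
  | zero =>
    obtain ⟨C, hC⟩ := hj 0
    exact ⟨C, fun j hj0 y hy ↦ by rw [Nat.le_zero.1 hj0]; exact hC y hy⟩
  | succ n ih =>
    obtain ⟨C, hC⟩ := ih
    obtain ⟨C', hC'⟩ := hj (n + 1)
    refine ⟨max C C', fun j hjn y hy ↦ ?_⟩
    rcases Nat.of_le_succ hjn with h | h
    · exact (hC j h y hy).trans (le_max_left _ _)
    · rw [h]; exact (hC' y hy).trans (le_max_right _ _)

end Bounds

/-! ### A smooth radial cut-off -/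

section Cutoff

variable {E : Type*} [NormedAddCommGroup E]

/-- **The radial cut-off** `φ(y) = smoothTransition ((σ₂² − ‖y‖²)/(σ₂² − σ₁²))` on a real inner
product space: smooth, values in `[0, 1]`, `= 1` on `{‖y‖ ≤ σ₁}` and `= 0` on `{σ₂ ≤ ‖y‖}` (for
`0 ≤ σ₁ < σ₂`). [folklore] -/
def radialCutoff (σ₁ σ₂ : ℝ) (y : E) : ℝ :=
  Real.smoothTransition ((σ₂ ^ 2 - ‖y‖ ^ 2) / (σ₂ ^ 2 - σ₁ ^ 2))

/-- The radial cut-off is smooth. [folklore] -/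
theorem contDiff_radialCutoff [InnerProductSpace ℝ E] (σ₁ σ₂ : ℝ) :
    ContDiff ℝ ∞ (radialCutoff σ₁ σ₂ : E → ℝ) :=
  Real.smoothTransition.contDiff.comp ((contDiff_const.sub (contDiff_norm_sq ℝ)).div_const _)

/-- `0 ≤ φ`. [folklore] -/
theorem radialCutoff_nonneg (σ₁ σ₂ : ℝ) (y : E) : 0 ≤ radialCutoff σ₁ σ₂ y :=
  Real.smoothTransition.nonneg _

/-- `φ ≤ 1`. [folklore] -/
theorem radialCutoff_le_one (σ₁ σ₂ : ℝ) (y : E) : radialCutoff σ₁ σ₂ y ≤ 1 :=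
  Real.smoothTransition.le_one _

/-- `φ = 1` on `{‖y‖ ≤ σ₁}` (`0 ≤ σ₁ < σ₂`). [folklore] -/
theorem radialCutoff_of_norm_le {σ₁ σ₂ : ℝ} (h₁ : 0 ≤ σ₁) (h₁₂ : σ₁ < σ₂) {y : E} (hy : ‖y‖ ≤ σ₁) :
    radialCutoff σ₁ σ₂ y = 1 := by
  have hden : 0 < σ₂ ^ 2 - σ₁ ^ 2 := by nlinarith
  refine Real.smoothTransition.one_of_one_le ((one_le_div hden).2 ?_)
  have h : ‖y‖ ^ 2 ≤ σ₁ ^ 2 := pow_le_pow_left₀ (norm_nonneg y) hy 2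
  linarith

/-- `φ = 0` on `{σ₂ ≤ ‖y‖}` (`0 ≤ σ₁ < σ₂`). [folklore] -/
theorem radialCutoff_of_le_norm {σ₁ σ₂ : ℝ} (h₁ : 0 ≤ σ₁) (h₁₂ : σ₁ < σ₂) {y : E} (hy : σ₂ ≤ ‖y‖) :
    radialCutoff σ₁ σ₂ y = 0 := by
  have hden : 0 < σ₂ ^ 2 - σ₁ ^ 2 := by nlinarith
  refine Real.smoothTransition.zero_of_nonpos (div_nonpos_of_nonpos_of_nonneg ?_ hden.le)
  have h : σ₂ ^ 2 ≤ ‖y‖ ^ 2 := pow_le_pow_left₀ (h₁.trans h₁₂.le) hy 2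
  linarith

/-- `φ = 1` near every point of the open ball `{‖y‖ < σ₁}`. [folklore] -/
theorem radialCutoff_eventually_eq_one {σ₁ σ₂ : ℝ} (h₁ : 0 ≤ σ₁) (h₁₂ : σ₁ < σ₂) {y : E}
    (hy : ‖y‖ < σ₁) : ∀ᶠ z in 𝓝 y, radialCutoff σ₁ σ₂ z = 1 := by
  filter_upwards [(isOpen_lt continuous_norm continuous_const).mem_nhds hy] with z hz
  exact radialCutoff_of_norm_le h₁ h₁₂ (le_of_lt hz)

/-- `φ = 0` near every point of `{σ₂ < ‖y‖}`. [folklore] -/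
theorem radialCutoff_eventually_eq_zero {σ₁ σ₂ : ℝ} (h₁ : 0 ≤ σ₁) (h₁₂ : σ₁ < σ₂) {y : E}
    (hy : σ₂ < ‖y‖) : ∀ᶠ z in 𝓝 y, radialCutoff σ₁ σ₂ z = 0 := by
  filter_upwards [(isOpen_lt continuous_const continuous_norm).mem_nhds hy] with z hz
  exact radialCutoff_of_le_norm h₁ h₁₂ (le_of_lt hz)

end Cutoff

/-! ### Interpolation of initial data sets on `E3` -/

/-- Smoothness of a cut-off interpolation `φ • G₁ + (1 − φ) • G₂` of vector-valued maps.
[folklore] -/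
theorem contDiff_smul_add_one_sub_smul {E : Type*} [NormedAddCommGroup E] [NormedSpace ℝ E]
    {F : Type*} [NormedAddCommGroup F] [NormedSpace ℝ F] {n : ℕ∞ω} {φ : E → ℝ} {G₁ G₂ : E → F}
    (hφ : ContDiff ℝ n φ) (h₁ : ContDiff ℝ n G₁) (h₂ : ContDiff ℝ n G₂) :
    ContDiff ℝ n (fun z ↦ φ z • G₁ z + (1 - φ z) • G₂ z) :=
  (hφ.smul h₁).add ((contDiff_const.sub hφ).smul h₂)

namespace InitialDataSet

variable (φ : E3 → ℝ) (D₁ D₂ : InitialDataSet (𝓡 3) E3)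

/-- The interpolated metric field `h̃ = φ h₁ + (1 − φ) h₂`, as a map `E3 → (E3 →L E3 →L ℝ)`.
[cite: LiMei2020, proof of Prop. 4.1, p. 22] -/
def interpH (y : E3) : E3 →L[ℝ] E3 →L[ℝ] ℝ :=
  φ y • D₁.coordH y + (1 - φ y) • D₂.coordH y

/-- The interpolated tensor `k̃ = φ k₁ + (1 − φ) k₂`, as a map `E3 → (E3 →L E3 →L ℝ)`.
[cite: LiMei2020, proof of Prop. 4.1, p. 22] -/
def interpK (y : E3) : E3 →L[ℝ] E3 →L[ℝ] ℝ :=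
  φ y • D₁.coordK y + (1 - φ y) • D₂.coordK y

/-- `h̃(y)(v, w) = φ(y) h₁(y)(v, w) + (1 − φ(y)) h₂(y)(v, w)`. [folklore] -/
@[simp]
theorem interpH_apply (y v w : E3) :
    interpH φ D₁ D₂ y v w = φ y * D₁.h.inner y v w + (1 - φ y) * D₂.h.inner y v w := by
  simp only [interpH, add_apply, smul_apply, smul_eq_mul, coordH_apply]

/-- `k̃(y)(v, w) = φ(y) k₁(y)(v, w) + (1 − φ(y)) k₂(y)(v, w)`. [folklore] -/
@[simp]
theorem interpK_apply (y v w : E3) :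
    interpK φ D₁ D₂ y v w = φ y * D₁.k y v w + (1 - φ y) * D₂.k y v w := by
  simp only [interpK, add_apply, smul_apply, smul_eq_mul, coordK_apply]

variable {φ}

/-- `h̃` is smooth for smooth `φ`. [folklore] -/
theorem contDiff_interpH (hφ : ContDiff ℝ ∞ φ) : ContDiff ℝ ∞ (interpH φ D₁ D₂) :=
  contDiff_smul_add_one_sub_smul hφ D₁.contMDiff_coordH.contDiff D₂.contMDiff_coordH.contDiff

/-- `k̃` is smooth for smooth `φ`. [folklore] -/
theorem contDiff_interpK (hφ : ContDiff ℝ ∞ φ) : ContDiff ℝ ∞ (interpK φ D₁ D₂) :=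
  contDiff_smul_add_one_sub_smul hφ D₁.contMDiff_coordK.contDiff D₂.contMDiff_coordK.contDiff

/-- **A convex combination of Riemannian metrics is Riemannian**: `h̃(y)(v, v) > 0` for `v ≠ 0`
when `0 ≤ φ(y) ≤ 1`. [folklore] -/
theorem interpH_pos {y : E3} (h0 : 0 ≤ φ y) (h1 : φ y ≤ 1) {v : E3} (hv : v ≠ 0) :
    0 < interpH φ D₁ D₂ y v v := by
  rw [interpH_apply]
  have ha := D₁.h.pos y v hv
  have hb := D₂.h.pos y v hv
  rcases h0.eq_or_lt with h | h
  · rw [← h]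
    simpa using hb
  · nlinarith [mul_pos h ha, mul_nonneg (sub_nonneg.2 h1) hb.le]

/-- **The interpolated initial data set** `(h̃, k̃) = (φ h₁ + (1 − φ) h₂, φ k₁ + (1 − φ) k₂)` on
`E3`, for a smooth cut-off `φ : E3 → [0, 1]` and two initial data sets `D₁ = (h₁, k₁)`,
`D₂ = (h₂, k₂)`: `h̃` is Riemannian (convex combination), `k̃` symmetric, both smooth. This is the
first step of the gluing in Li–Mei arXiv:2005.01249, proof of Prop. 4.1, p. 22
("`(g̃, π̃) = (φ ḡ + (1 − φ) ḡ_{m,a⃗}, φ π̄ + (1 − φ) π̄_{m,a⃗})`"), and of Corvino 2000, §4.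
[cite: LiMei2020, proof of Prop. 4.1, p. 22] -/
def interpolate (hφ : ContDiff ℝ ∞ φ) (h01 : ∀ y, 0 ≤ φ y ∧ φ y ≤ 1) : InitialDataSet (𝓡 3) E3 where
  h :=
    { inner := fun y ↦ interpH φ D₁ D₂ y
      symm := fun y v w ↦ by
        show interpH φ D₁ D₂ y v w = interpH φ D₁ D₂ y w v
        rw [interpH_apply, interpH_apply, D₁.h.symm y v w, D₂.h.symm y v w]
      pos := fun y v hv ↦ interpH_pos D₁ D₂ (h01 y).1 (h01 y).2 hv
      isVonNBounded := fun y ↦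
        PseudoRiemannianMetric.IsSpacelikeImmersion.isVonNBounded_setOf_lt_one_of_pos (V := E3)
          (interpH φ D₁ D₂ y) (fun v hv ↦ interpH_pos D₁ D₂ (h01 y).1 (h01 y).2 hv)
      contMDiff := fun y ↦ (contMDiffAt_bilinE3_iff (b := fun y : E3 ↦ y) (s := interpH φ D₁ D₂)).2
        ⟨contMDiffAt_id, (contDiff_interpH D₁ D₂ hφ).contDiffAt.contMDiffAt⟩ }
  k := fun y ↦ interpK φ D₁ D₂ y
  k_symm := fun y v w ↦ by
    show interpK φ D₁ D₂ y v w = interpK φ D₁ D₂ y w v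
    rw [interpK_apply, interpK_apply, D₁.k_symm y v w, D₂.k_symm y v w]
  contMDiff_k := fun y ↦ (contMDiffAt_bilinE3_iff (b := fun y : E3 ↦ y) (s := interpK φ D₁ D₂)).2
    ⟨contMDiffAt_id, (contDiff_interpK D₁ D₂ hφ).contDiffAt.contMDiffAt⟩

variable (hφ : ContDiff ℝ ∞ φ) (h01 : ∀ y, 0 ≤ φ y ∧ φ y ≤ 1)

/-- The metric of the interpolated data is `h̃ = interpH`. [folklore] -/
@[simp]
theorem interpolate_h_inner (y : E3) : (interpolate D₁ D₂ hφ h01).h.inner y = interpH φ D₁ D₂ y :=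
  rfl

/-- The tensor `k` of the interpolated data is `k̃ = interpK`. [folklore] -/
@[simp]
theorem interpolate_k (y : E3) : (interpolate D₁ D₂ hφ h01).k y = interpK φ D₁ D₂ y := rfl

/-- `h̃(y)(v, w) = φ h₁(v, w) + (1 − φ) h₂(v, w)`. [cite: LiMei2020, proof of Prop. 4.1, p. 22] -/
theorem interpolate_h_inner_apply (y v w : E3) :
    (interpolate D₁ D₂ hφ h01).h.inner y v w =
      φ y * D₁.h.inner y v w + (1 - φ y) * D₂.h.inner y v w :=
  interpH_apply φ D₁ D₂ y v w

/-- `k̃(y)(v, w) = φ k₁(v, w) + (1 − φ) k₂(v, w)`. [cite: LiMei2020, proof of Prop. 4.1, p. 22] -/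
theorem interpolate_k_apply (y v w : E3) :
    (interpolate D₁ D₂ hφ h01).k y v w = φ y * D₁.k y v w + (1 - φ y) * D₂.k y v w :=
  interpK_apply φ D₁ D₂ y v w

/-- **Where `φ = 1` the interpolated metric is `h₁`.** [folklore] -/
theorem interpolate_h_inner_of_eq_one {y : E3} (hy : φ y = 1) :
    (interpolate D₁ D₂ hφ h01).h.inner y = D₁.h.inner y := by
  refine ContinuousLinearMap.ext fun v ↦ ContinuousLinearMap.ext fun w ↦ ?_
  have h : interpH φ D₁ D₂ y v w = D₁.h.inner y v w := by
    rw [interpH_apply, hy]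
    ring
  exact h

/-- **Where `φ = 1` the interpolated `k` is `k₁`.** [folklore] -/
theorem interpolate_k_of_eq_one {y : E3} (hy : φ y = 1) :
    (interpolate D₁ D₂ hφ h01).k y = D₁.k y := by
  refine ContinuousLinearMap.ext fun v ↦ ContinuousLinearMap.ext fun w ↦ ?_
  have h : interpK φ D₁ D₂ y v w = D₁.k y v w := by
    rw [interpK_apply, hy]
    ring
  exact h

/-- **Where `φ = 0` the interpolated metric is `h₂`.** [folklore] -/
theorem interpolate_h_inner_of_eq_zero {y : E3} (hy : φ y = 0) :
    (interpolate D₁ D₂ hφ h01).h.inner y = D₂.h.inner y := by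
  refine ContinuousLinearMap.ext fun v ↦ ContinuousLinearMap.ext fun w ↦ ?_
  have h : interpH φ D₁ D₂ y v w = D₂.h.inner y v w := by
    rw [interpH_apply, hy]
    ring
  exact h

/-- **Where `φ = 0` the interpolated `k` is `k₂`.** [folklore] -/
theorem interpolate_k_of_eq_zero {y : E3} (hy : φ y = 0) :
    (interpolate D₁ D₂ hφ h01).k y = D₂.k y := by
  refine ContinuousLinearMap.ext fun v ↦ ContinuousLinearMap.ext fun w ↦ ?_
  have h : interpK φ D₁ D₂ y v w = D₂.k y v w := by
    rw [interpK_apply, hy]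
    ring
  exact h

/-- **Locality: where `φ` is locally `1`, the Hamiltonian constraint function of the interpolated
data is that of `D₁`** (Bartnik–Isenberg 2004, §2; `hamiltonianConstraintFn_congr`).
[cite: BartnikIsenberg2004, §2] -/
theorem hamiltonianConstraintFn_interpolate_of_eventually_eq_one
    [(interpolate D₁ D₂ hφ h01).metric.HasLeviCivita] [D₁.metric.HasLeviCivita] {y : E3}
    (hy : ∀ᶠ z in 𝓝 y, φ z = 1) :
    (interpolate D₁ D₂ hφ h01).hamiltonianConstraintFn y = D₁.hamiltonianConstraintFn y :=
  hamiltonianConstraintFn_congr (hy.mono fun _ hz ↦ interpolate_h_inner_of_eq_one D₁ D₂ hφ h01 hz)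
    (hy.mono fun _ hz ↦ interpolate_k_of_eq_one D₁ D₂ hφ h01 hz)

/-- **Locality: where `φ` is locally `1`, the momentum constraint covector of the interpolated data
is that of `D₁`** (`momentumConstraintFn_congr`). [cite: BartnikIsenberg2004, §2] -/
theorem momentumConstraintFn_interpolate_of_eventually_eq_one
    [(interpolate D₁ D₂ hφ h01).metric.HasLeviCivita] [D₁.metric.HasLeviCivita] {y : E3}
    (hy : ∀ᶠ z in 𝓝 y, φ z = 1) :
    (interpolate D₁ D₂ hφ h01).momentumConstraintFn y = D₁.momentumConstraintFn y :=
  momentumConstraintFn_congr (hy.mono fun _ hz ↦ interpolate_h_inner_of_eq_one D₁ D₂ hφ h01 hz)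
    (hy.mono fun _ hz ↦ interpolate_k_of_eq_one D₁ D₂ hφ h01 hz)

/-- **Locality: where `φ` is locally `0`, the Hamiltonian constraint function of the interpolated
data is that of `D₂`.** [cite: BartnikIsenberg2004, §2] -/
theorem hamiltonianConstraintFn_interpolate_of_eventually_eq_zero
    [(interpolate D₁ D₂ hφ h01).metric.HasLeviCivita] [D₂.metric.HasLeviCivita] {y : E3}
    (hy : ∀ᶠ z in 𝓝 y, φ z = 0) :
    (interpolate D₁ D₂ hφ h01).hamiltonianConstraintFn y = D₂.hamiltonianConstraintFn y :=
  hamiltonianConstraintFn_congr (hy.mono fun _ hz ↦ interpolate_h_inner_of_eq_zero D₁ D₂ hφ h01 hz)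
    (hy.mono fun _ hz ↦ interpolate_k_of_eq_zero D₁ D₂ hφ h01 hz)

/-- **Locality: where `φ` is locally `0`, the momentum constraint covector of the interpolated data
is that of `D₂`.** [cite: BartnikIsenberg2004, §2] -/
theorem momentumConstraintFn_interpolate_of_eventually_eq_zero
    [(interpolate D₁ D₂ hφ h01).metric.HasLeviCivita] [D₂.metric.HasLeviCivita] {y : E3}
    (hy : ∀ᶠ z in 𝓝 y, φ z = 0) :
    (interpolate D₁ D₂ hφ h01).momentumConstraintFn y = D₂.momentumConstraintFn y :=
  momentumConstraintFn_congr (hy.mono fun _ hz ↦ interpolate_h_inner_of_eq_zero D₁ D₂ hφ h01 hz)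
    (hy.mono fun _ hz ↦ interpolate_k_of_eq_zero D₁ D₂ hφ h01 hz)

end InitialDataSet

end Literature.Geometry.Lorentzian

end
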